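import Mathlib
import Summits.MatrixMultiplication.MatrixMultiplication.Theses.LevelGradedCohnUmans

/-!
# Sketch — crux-ideate round 2, ideator 4: `slab-exchange` (J₂-free packaging of the slab-rank refutation)

Crux: `LevelGradedCohnUmans.LevelTwoBeatsCubes` (item stmt-MatrixMultiplication-7612).
Lever (same as round-1 `graded-neumann-rank`): a 2-token separated triple carries
`|X||Z| + |X|(|Y|-1)` linearly independent TEST FUNCTIONS (separators and right-translated
separators), all lying in the span of an explicit family of `E′(n) = 1+(n-1)²+(n-1)²(n-2)²/2`
functions (and of the `n!` delta functions), so by the exchange lemma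
(`linearIndependent_le_span_aux'`) `|X|(|Y|+|Z|-1) ≤ min(n!, E′(n))`; with the mirror inequality
and arithmetic, `|X||Y||Z| ≤ B₃(n)` for every `n`. No submodule `J₂`, no `finrank`, no dual space,
no representation theory.
-/

namespace Summit.MatrixMultiplication.MatrixMultiplication.Cruxes.LevelTwoBeatsCubes.SlabExchange

open Finset
open Summit.MatrixMultiplication.MatrixMultiplication.Theses.LevelGradedCohnUmans

/-- The crux's separation clause, verbatim. -/
def TwoTokenSeparated {n : ℕ} (X Y Z : Finset (Equiv.Perm (Fin n))) : Prop :=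
  ∀ x₀ ∈ X, ∀ z₀ ∈ Z, ∃ c : (Fin 2 → Fin n) → (Fin 2 → Fin n) → ℂ, ∀ x ∈ X, ∀ y ∈ Y, ∀ y' ∈ Y,
    ∀ z ∈ Z, (∑ p : Fin 2 → Fin n, c p (⇑(x⁻¹ * y * y'⁻¹ * z) ∘ p)) =
      if x = x₀ ∧ y = y' ∧ z = z₀ then 1 else 0

/-- The elementary dimension bound `E′(n) = 1 + (n-1)² + (n-1)²(n-2)²/2` (ℕ arithmetic; the product
`(n-1)²(n-2)²` is even). Values 1,1,2,7,28,89,226,487,932,1633 for n = 0..9. -/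
def ePrime (n : ℕ) : ℕ := 1 + (n - 1) ^ 2 + (n - 1) ^ 2 * (n - 2) ^ 2 / 2

/-- The crux's cube budget `B₃(n) = Σ_{λ₁ ≥ n-2} f_λ³` (verbatim ℕ expression of the crux). -/
def cubeBudget (n : ℕ) : ℕ := 1 + (n - 1) ^ 3 + (n * (n - 3) / 2) ^ 3 + ((n - 1) * (n - 2) / 2) ^ 3

/-- FIRST LEMMA (slab independence, J₂-free). `c x₀ z₀` is a chosen separating coefficient tensor for
the target `(x₀, z₀)`; `y₁ ∈ Y`, `z₁ ∈ Z` fix the slab. The `|X||Z|` separators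
`F_{x₀z₀}(g) = Σ_p c_{x₀z₀} p (g ∘ p)` together with the `|X|(|Y|-1)` right-translated separators
`H_{x₂y₂}(g) = F_{x₂z₁}(g · z₁⁻¹ y₁ y₂⁻¹ z₁)` (`y₂ ≠ y₁`) are linearly independent: a vanishing
combination evaluated at a slab point `x⁻¹ y y₁⁻¹ z₁` (`y ≠ y₁`) isolates the coefficient of `H_{xy}`
(every `F` vanishes there — non-target quadruple `(x,y,y₁,z₁)` — and `H_{x₂y₂}` there equals
`F_{x₂z₁}(x⁻¹ y y₂⁻¹ z₁) = [x=x₂][y=y₂]`); then evaluation at a target `x⁻¹z = x⁻¹ y₁ y₁⁻¹ z`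
isolates the coefficient of `F_{xz}`. Uses nothing about `J₂`. -/
theorem slab_independent {n : ℕ} {X Y Z : Finset (Equiv.Perm (Fin n))}
    (c : Equiv.Perm (Fin n) → Equiv.Perm (Fin n) → (Fin 2 → Fin n) → (Fin 2 → Fin n) → ℂ)
    (hc : ∀ x₀ ∈ X, ∀ z₀ ∈ Z, ∀ x ∈ X, ∀ y ∈ Y, ∀ y' ∈ Y, ∀ z ∈ Z,
      (∑ p : Fin 2 → Fin n, c x₀ z₀ p (⇑(x⁻¹ * y * y'⁻¹ * z) ∘ p)) =
        if x = x₀ ∧ y = y' ∧ z = z₀ then 1 else 0)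
    {y₁ z₁ : Equiv.Perm (Fin n)} (hy₁ : y₁ ∈ Y) (hz₁ : z₁ ∈ Z) :
    LinearIndependent ℂ (Sum.elim
      (fun t : ↥(X ×ˢ Z) => fun g : Equiv.Perm (Fin n) =>
        ∑ p : Fin 2 → Fin n, c t.1.1 t.1.2 p (⇑g ∘ p))
      (fun r : ↥(X ×ˢ (Y.erase y₁)) => fun g : Equiv.Perm (Fin n) =>
        ∑ p : Fin 2 → Fin n, c r.1.1 z₁ p (⇑(g * (z₁⁻¹ * y₁ * r.1.2⁻¹ * z₁)) ∘ p))) := by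
  sorry

/-- Point indicators `u i a (g) = [g i = a]` — the permutation-matrix entries as functions on `𝔖ₙ`. -/
def u {n : ℕ} (i a : Fin n) : Equiv.Perm (Fin n) → ℂ := fun g => if g i = a then 1 else 0

/-- Index set of the elementary spanning family: a unit (the constant function), the cells `(i,a)`
of the `(n-1) × (n-1)` grid (last row and column eliminated by the row/column-sum relations), and
the ordered representatives `((i,a),(j,b))`, `i < j`, `a ≠ b`, of unordered pairs of cells in
distinct rows and columns. Cardinality `E′(n)`. -/
def cellPairs (m : ℕ) : Finset ((Fin m × Fin m) × (Fin m × Fin m)) :=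
  Finset.univ.filter fun s => s.1.1 < s.2.1 ∧ s.1.2 ≠ s.2.2

/-- The elementary spanning family `B n` (size `E′(n)`): `1`, `u i a` (`i,a < n-1`),
`u i a * u j b` (`i<j<n-1`, `a ≠ b < n-1`). -/
def spanFamily (n : ℕ) :
    Unit ⊕ (Fin (n - 1) × Fin (n - 1)) ⊕ ↥(cellPairs (n - 1)) → (Equiv.Perm (Fin n) → ℂ) :=
  Sum.elim (fun _ => fun _ => 1) (Sum.elim
    (fun ia => u (Fin.castLE (Nat.sub_le n 1) ia.1) (Fin.castLE (Nat.sub_le n 1) ia.2))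
    (fun s => u (Fin.castLE (Nat.sub_le n 1) s.1.1.1) (Fin.castLE (Nat.sub_le n 1) s.1.1.2) *
      u (Fin.castLE (Nat.sub_le n 1) s.1.2.1) (Fin.castLE (Nat.sub_le n 1) s.1.2.2)))

/-- SECOND LEMMA (elementary span, no representation theory): every right-translated 2-token test
lies in the span of `spanFamily n` (`n ≥ 2`). Proof: the test is `Σ_{p,q} c p q · u_{p0,q0} u_{p1,q1}`
(translated: `u_{i a}(g w) = u_{w i, a}(g)`), each `u_{ia}` is an affine combination of
`{u_{i'a'} : i',a' < n-1} ∪ {1}` by `Σ_a u_{ia} = 1 = Σ_i u_{ia}`, and products reduce by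
`u_{ia} u_{ib} = δ_{ab} u_{ia}`, `u_{ia} u_{ja} = δ_{ij} u_{ia}`, `u_{ia}u_{jb} = u_{jb}u_{ia}`. -/
theorem test_mem_span {n : ℕ} (hn : 2 ≤ n) (c : (Fin 2 → Fin n) → (Fin 2 → Fin n) → ℂ)
    (w : Equiv.Perm (Fin n)) :
    (fun g : Equiv.Perm (Fin n) => ∑ p : Fin 2 → Fin n, c p (⇑(g * w) ∘ p)) ∈
      Submodule.span ℂ (Set.range (spanFamily n)) := by
  sorry

/-- Cardinality of the index set: `E′(n)` for `n ≥ 2`. -/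
theorem card_index (n : ℕ) (hn : 2 ≤ n) :
    Fintype.card (Unit ⊕ (Fin (n - 1) × Fin (n - 1)) ⊕ ↥(cellPairs (n - 1))) = ePrime n := by
  sorry

/-- THE PACKING INEQUALITY (graded Neumann, X-form), J₂-free: exchange lemma
`linearIndependent_le_span_aux'` applied to `slab_independent` inside `span (range (spanFamily n))`
(for `n ≥ 2`) and inside the span of the `n!` delta functions (all `n`). -/
theorem slab_packing {n : ℕ} {X Y Z : Finset (Equiv.Perm (Fin n))} (hsep : TwoTokenSeparated X Y Z)
    (hY : Y.Nonempty) (hZ : Z.Nonempty) :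
    X.card * Z.card + X.card * (Y.card - 1) ≤ min n.factorial (ePrime n) := by
  sorry

/-- Mirror form (apply `slab_packing` to `(Z⁻¹, Y⁻¹, X⁻¹)`, separated by `g ↦ f(g⁻¹)`, which is again
a 2-token test since `(g⁻¹ ∘ p = q) ↔ (g ∘ q = p)`; or repeat the proof with left translations). -/
theorem slab_packing' {n : ℕ} {X Y Z : Finset (Equiv.Perm (Fin n))} (hsep : TwoTokenSeparated X Y Z)
    (hX : X.Nonempty) (hY : Y.Nonempty) :
    X.card * Z.card + Z.card * (Y.card - 1) ≤ min n.factorial (ePrime n) := by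
  sorry

/-- ARITHMETIC: under the two packing constraints with `D = min(n!, E′(n))`, `m t p ≤ B₃(n)` for
every `n` (one-variable relaxation `V ≤ max_p (pD - p³ + p²)`; for `p ≥ 3`, `V² ≤ 2D³/9` and
`9 B₃(n)² - 2 E′(n)³` is a polynomial in `n-5` with non-negative coefficients; `p ≤ 2`: `V ≤ 2D-4`;
`n ≤ 4`: `D = n!`, values 1,1,2,6,24 give `V ≤ 1,1,2,8,54 ≤ B₃ = 1,1,2,10,63`). -/
theorem cube_arith (n m t p : ℕ) (hm : 1 ≤ m) (ht : 1 ≤ t) (hp : 1 ≤ p)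
    (h₁ : m * p + m * (t - 1) ≤ min n.factorial (ePrime n))
    (h₂ : m * p + p * (t - 1) ≤ min n.factorial (ePrime n)) :
    m * t * p ≤ cubeBudget n := by
  sorry

/-- COMPOSITION (proved, no sorry): the four statements above refute the crux BY NAME. -/
theorem not_LevelTwoBeatsCubes_of
    (hpack : ∀ {n : ℕ} {X Y Z : Finset (Equiv.Perm (Fin n))}, TwoTokenSeparated X Y Z →
      Y.Nonempty → Z.Nonempty → X.card * Z.card + X.card * (Y.card - 1) ≤ min n.factorial (ePrime n))
    (hpack' : ∀ {n : ℕ} {X Y Z : Finset (Equiv.Perm (Fin n))}, TwoTokenSeparated X Y Z →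
      X.Nonempty → Y.Nonempty → X.card * Z.card + Z.card * (Y.card - 1) ≤ min n.factorial (ePrime n))
    (harith : ∀ n m t p : ℕ, 1 ≤ m → 1 ≤ t → 1 ≤ p →
      m * p + m * (t - 1) ≤ min n.factorial (ePrime n) →
      m * p + p * (t - 1) ≤ min n.factorial (ePrime n) → m * t * p ≤ cubeBudget n) :
    ¬ LevelTwoBeatsCubes := by
  rintro ⟨n, X, Y, Z, hsep, hV⟩
  have hsep' : TwoTokenSeparated X Y Z := hsep
  -- nonemptiness from `B₃(n) < |X||Y||Z|` (so the product is positive)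
  have hpos : 0 < X.card * Y.card * Z.card := lt_of_le_of_lt (Nat.zero_le _) hV
  have hX : X.Nonempty := by
    rw [← Finset.card_pos]; exact Nat.pos_of_ne_zero fun h => by simp [h] at hpos
  have hY : Y.Nonempty := by
    rw [← Finset.card_pos]; exact Nat.pos_of_ne_zero fun h => by simp [h] at hpos
  have hZ : Z.Nonempty := by
    rw [← Finset.card_pos]; exact Nat.pos_of_ne_zero fun h => by simp [h] at hpos
  have h₁ := hpack hsep' hY hZ
  have h₂ := hpack' hsep' hX hY
  have hle := harith n X.card Y.card Z.card (Finset.card_pos.mpr hX) (Finset.card_pos.mpr hY)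
    (Finset.card_pos.mpr hZ) h₁ (by simpa [Nat.mul_comm] using h₂)
  have hle' : X.card * Y.card * Z.card ≤ cubeBudget n := by
    simpa [Nat.mul_comm, Nat.mul_assoc, Nat.mul_left_comm] using hle
  exact absurd (lt_of_lt_of_le hV hle') (lt_irrefl _)

/-- Sanity: the typed budget and the elementary bound at small `n`. -/
example : (List.range 8).map cubeBudget = [1, 1, 2, 10, 63, 406, 1855, 6336] := by decide
example : (List.range 8).map ePrime = [1, 1, 2, 7, 28, 89, 226, 487] := by decide

end Summit.MatrixMultiplication.MatrixMultiplication.Cruxes.LevelTwoBeatsCubes.SlabExchange
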